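import Literature.NumberTheory.DiophantineGeometry.SUnitAbcBoundsCongruenceNumberFreyCurveProofs
import Literature.NumberTheory.EllipticCurves.ModularMethodEpsShapeBoundProofs
import Literature.NumberTheory.DiophantineGeometry.AbcWave0SUnitProofs
import HarnessLib

/-!
# Murty–Pasten 2013, Theorems 1.1–1.2, asymptotic clauses: the §8 deduction from Theorem 7.1,
# and both clauses on the base {modularity, Mazur–Kenku}

Topic `Literature/NumberTheory/DiophantineGeometry` (family `abc`; LADDER-ABC A1, the *modular method*).
A proofs-only companion (theorems only; NO definition, NO new named fact, nothing restated; D-0014,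
D-0026) of `SUnitAbcBoundsCongruenceNumber.lean` (M. R. Murty, H. Pasten, J. Number Theory **133**
(2013) 3739–3754 [`MurtyPasten2013`]: the named facts `MurtyPasten.abc_log_max_asymptotic` — Thm 1.2,
second part, `log max{|A|,|B|,|C|} ≤ 4 R log R + O(R log log R)` — and
`MurtyPasten.sUnit_height_asymptotic` — Thm 1.1, second part, `max{h(U),h(V)} < 4 P log P + O(P log log P)`)
and of `CongruenceNumberLevelBound.lean` (Thm 7.1, second part = the named fact
`EllipticCurves.MurtyPasten.height_discriminant_asymptotic`, `log|Δ_E| < N log N + O(N log log N)`).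
Version of record HELD (`paper:url-b819d9c52ca6`), read at pp. 3752–3753: *"For the second part one
does the same computation using the second part of Theorem 7.1 instead"* (proof of Thm 1.2, §8) and
*"we can write `U = −A/C`, `V = −B/C` for `A, B, C` non-zero coprime integers whose prime factors
belong to `S` (in particular `rad(ABC)` divides the product of the primes in `S`) …
`max{h(U), h(V)} = log max{|A|,|B|,|C|}`"* (proof of Thm 1.1).

## Contents (all PROVED; the curve and the first display are in
`SUnitAbcBoundsCongruenceNumberFreyCurveProofs.lean`)

* `abc_log_max_asymptotic_of_height_discriminant_asymptotic` — **Thm 7.1 (second part) ⟹ Thm 1.2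
  (second part)**, "the same computation": with `log|Δ_E| < N log N + K N log log N` (`N ≥ N₀`) on the
  curve of `exists_freyCurve_of_abc`, `4 log max ≤ log|Δ_E| + 10 log 2`, `N ≤ 16R`,
  `log log(16R) ≤ 2 log log R` and `16 log 16 · R + 10 log 2 ≤ 52 R log log R` (`R ≥ 16`): constant
  `8 max(K,0) + 13`, threshold `max(16, 2N₀)` (`R ≤ 2N_E`).
* `sUnit_height_asymptotic_of_abc_log_max_asymptotic` — **Thm 1.2 (second part) ⟹ Thm 1.1 (second
  part)** by the translation of §8 (`exists_abc_of_sUnit`): `R log R ≤ P log P`,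
  `R log log R ≤ P log log P` above the radical threshold; the triples below it have all prime factors
  `< r₁`, hence are finitely many (Mahler 1933; tree theorem
  `finite_setOf_isABCTriple_primeFactors_subset_holds`) and their heights go into the `O`-constant.
  (The tree's `sUnit_height_asymptotic_of_abc` uses the explicit clause of Thm 1.2 there instead.)
* `…_of_modularity_mazurKenku` — both clauses from {modularity with an integral Manin constant
  `nonempty_modularParametrizationData`, Mazur–Kenku `PastenShimura2024_minimalDegree_le_163_mul`},
  the trust base of the A1.P column (`epsShapeBound_one_of_modularity_mazurKenku`), through MP's own
  chain: Thm 4.3 asymptotic (DISCHARGED, `log_congruenceNumber_modularDegree_asymptotic_holds`),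
  Prop 6.3, Thm 5.4/Silverman — `EllipticCurves.MurtyPasten.height_discriminant_asymptotic_of_modularity_mazurKenku`
  — then §8 with Diamond–Kramer's `2⁴` (von Känel–Matschke's Lemma 10.5, a tree theorem). Before
  this file the two clauses were derived only from the von Känel–Matschke §10 roots {modularity,
  `vonKanelMatschke_prop_10_8_i`} (`abc_log_max_asymptotic_of_roots`, `sUnit_height_asymptotic_of_roots`
  in `SUnitMordellFirstModularityBoundsProofs.lean`).

* `sUnit_height_lt_weak_of_modularity_mazurKenku` — the explicit `S`-unit clause in the form the §8
  argument yields on the same base: `max{h(U),h(V)} < 4.8 P log P + 13.31 P + 38.75` (DERIVED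
  constants; print's `13 P + 25` = the named fact `sUnit_height_lt` ⇐ von Känel–Matschke Prop. 10.2).

No `abc` claim (implications between named facts / conditional on two named facts; shape `θ₀ = 1`);
typed ≠ endorsed. Axioms standard.

## References

* [MurtyPasten2013] M. R. Murty, H. Pasten, J. Number Theory 133 (2013) 3739–3754: Thm 1.1 (p. 3740),
  Thm 1.2 (p. 3741), Thm 7.1 (pp. 3751–3752), §8 (pp. 3752–3753). doi:10.1016/j.jnt.2013.05.006.
* [Mahler1933a] K. Mahler, Math. Ann. 107 (1933) 691–730 (finiteness of the `S`-unit equation over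
  `ℚ`; tree theorem `finite_setOf_isABCTriple_primeFactors_subset_holds`).
* [DiamondKramer1995] F. Diamond, K. Kramer, Math. Res. Lett. 2 (1995) 299–304.
-/

noncomputable section

open Height UniqueFactorizationMonoid WeierstrassCurve

namespace Literature.NumberTheory.DiophantineGeometry

namespace MurtyPasten

open VonKanelMatschke Literature.NumberTheory.EllipticCurves.ModularForms

/-! ### Real-analysis bookkeeping for §8 ("the same computation") -/

/-- `log 16 ≤ 2.78` (`= 4 log 2`). [folklore] -/
private theorem log_sixteen_le_d3 : Real.log 16 ≤ 2.78 := by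
  have h16 : Real.log 16 = 4 * Real.log 2 := by
    rw [show (16 : ℝ) = 2 ^ 4 by norm_num, Real.log_pow]; norm_num
  have := Real.log_two_lt_d9
  linarith

/-- `2.77 ≤ log 16`. [folklore] -/
private theorem d3_le_log_sixteen : 2.77 ≤ Real.log 16 := by
  have h16 : Real.log 16 = 4 * Real.log 2 := by
    rw [show (16 : ℝ) = 2 ^ 4 by norm_num, Real.log_pow]; norm_num
  have := Real.log_two_gt_d9
  linarith

/-- `1 ≤ log log x` for real `x ≥ 16` (`log 16 > 2.77 > e`). [folklore] -/
private theorem one_le_log_log_of_sixteen_le {x : ℝ} (hx : 16 ≤ x) : 1 ≤ Real.log (Real.log x) := by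
  have he := Real.exp_one_lt_d9
  have hlog16 : Real.log 16 ≤ Real.log x := Real.log_le_log (by norm_num) hx
  have h277 := d3_le_log_sixteen
  have hlogx : 0 < Real.log x := by linarith
  rw [Real.le_log_iff_exp_le hlogx]
  linarith

/-- `log log (16 x) ≤ 2 log log x` for real `x ≥ 16`: `log(16x) ≤ 2 log x` and `log 2 ≤ log log x`.
[folklore] -/
private theorem log_log_sixteen_mul_le_two_mul {x : ℝ} (hx : 16 ≤ x) :
    Real.log (Real.log (16 * x)) ≤ 2 * Real.log (Real.log x) := by
  have hx0 : 0 < x := by linarith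
  have hlog16 : Real.log 16 ≤ Real.log x := Real.log_le_log (by norm_num) hx
  have h277 := d3_le_log_sixteen
  have hlogx : 0 < Real.log x := by linarith
  have h1 : Real.log (16 * x) ≤ 2 * Real.log x := by
    rw [Real.log_mul (by norm_num) hx0.ne']; linarith
  have h2 : Real.log (Real.log (16 * x)) ≤ Real.log (2 * Real.log x) :=
    Real.log_le_log (Real.log_pos (by linarith)) h1
  have h3 : Real.log (2 * Real.log x) = Real.log 2 + Real.log (Real.log x) :=
    Real.log_mul (by norm_num) hlogx.ne'
  -- `log 2 ≤ log log x` since `2 ≤ log x`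
  have h4 : Real.log 2 ≤ Real.log (Real.log x) := Real.log_le_log (by norm_num) (by linarith)
  linarith

/-- `x log x` is monotone on `[1, ∞)`. [folklore] -/
private theorem mul_log_mono_of_one_le {x y : ℝ} (hx : 1 ≤ x) (hxy : x ≤ y) :
    x * Real.log x ≤ y * Real.log y :=
  mul_le_mul hxy (Real.log_le_log (by linarith) hxy) (Real.log_nonneg hx) (by linarith)

/-- `max{|A|,|B|,|C|}` as the cast of `max` of the `natAbs`. [folklore] -/
private theorem abs_max_eq_cast_natAbs_max (a b c : ℤ) :
    max |a| (max |b| |c|) = ((max a.natAbs (max b.natAbs c.natAbs) : ℕ) : ℤ) := by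
  simp only [Nat.cast_max, Int.natCast_natAbs]

/-! ### Thm 1.2, asymptotic clause, from Thm 7.1, asymptotic clause (§8) -/

/-- **Murty–Pasten 2013, §8: Thm 7.1 (asymptotic clause `log|Δ_E| < N log N + O(N log log N)`)
⟹ Thm 1.2 (asymptotic clause `log max{|A|,|B|,|C|} ≤ 4 R log R + O(R log log R)`)** — "For the
second part one does the same computation using the second part of Theorem 7.1" (p. 3752): with the
Frey–Hellegouarch curve `E` of `(A, B, C)` (`2⁸|Δ_E| ≥ (ABC)²`, `N_E ∣ 2⁴R`, Diamond–Kramer — in the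
tree von Känel–Matschke's Lemma 10.5, PROVED), `4 log max − 2 log 2 ≤ log|Δ_E| + 8 log 2 <
N log N + K N log log N ≤ 16 R log(16R) + 16 K⁺ R log log(16R)`, and `log log(16R) ≤ 2 log log R`,
`16 log 16 · R + 10 log 2 ≤ 52 R log log R` for `R ≥ 16`: constant `C = 8 max(K,0) + 13`, threshold
`r₀ = max(16, 2N₀)` (`R ≤ 2 N_E` as every odd prime of `ABC` divides `N_E`). PROVED implication
between the two named facts `EllipticCurves.MurtyPasten.height_discriminant_asymptotic` and
`MurtyPasten.abc_log_max_asymptotic`. [cite: MurtyPasten2013, §8 (proof of Thm 1.2, p. 3752) with Thm 7.1 (second part)] -/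
theorem abc_log_max_asymptotic_of_height_discriminant_asymptotic
    (h71 : EllipticCurves.MurtyPasten.height_discriminant_asymptotic) : abc_log_max_asymptotic := by
  obtain ⟨K, N₀, hK⟩ := h71
  set K' : ℝ := max K 0 with hK'def
  have hK'0 : 0 ≤ K' := le_max_right _ _
  have hKK' : K ≤ K' := le_max_left _ _
  refine ⟨8 * K' + 13, max 16 (2 * N₀), fun a b c ha hb hc habc hg hr => ?_⟩
  obtain ⟨W, hW, hN, hΔ, hrad⟩ := exists_freyCurve_of_abc ha hb hc habc hg
  have hNpos : 0 < W.conductorNorm ℤ := WeierstrassCurve.conductorNorm_pos_holds W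
  set R : ℝ := ((radical (a * b * c).natAbs : ℕ) : ℝ) with hRdef
  have hR16 : (16 : ℝ) ≤ R := (le_max_left _ _).trans hr
  have hRN₀ : (2 * N₀ : ℝ) ≤ R := (le_max_right _ _).trans hr
  -- `N ≤ 16 R`, `R ≤ 2 N`
  have hN16 : ((W.conductorNorm ℤ : ℕ) : ℝ) ≤ 16 * R := by
    have h := Nat.le_of_dvd (by positivity) hN
    rw [hRdef]; exact_mod_cast h
  have hR2N : R ≤ 2 * ((W.conductorNorm ℤ : ℕ) : ℝ) := by
    have h := Nat.le_of_dvd (by positivity) hrad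
    rw [hRdef]; exact_mod_cast h
  have hN₀N : N₀ ≤ W.conductorNorm ℤ := by
    have : (N₀ : ℝ) ≤ ((W.conductorNorm ℤ : ℕ) : ℝ) := by linarith
    exact_mod_cast this
  -- Thm 7.1 (asymptotic, discriminant clause) and §8's first display
  have h3 := (hK W hN₀N).2
  have h4 := four_mul_log_max_le ha hb hc habc hΔ
  set N : ℝ := ((W.conductorNorm ℤ : ℕ) : ℝ) with hNdef
  -- bookkeeping
  have hN8 : (8 : ℝ) ≤ N := by linarith
  have hlogN1 : 1 ≤ Real.log N := by
    rw [Real.le_log_iff_exp_le (by linarith)]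
    have := Real.exp_one_lt_d9; linarith
  have hR1 : (1 : ℝ) ≤ R := by linarith
  have hlogR : 2 ≤ Real.log R := by
    have := Real.log_le_log (by norm_num) hR16; have := d3_le_log_sixteen; linarith
  have hllR : 1 ≤ Real.log (Real.log R) := one_le_log_log_of_sixteen_le hR16
  have hNlogN : N * Real.log N ≤ 16 * R * Real.log (16 * R) :=
    mul_log_mono_of_one_le (by linarith) hN16
  have hlog16R : Real.log (16 * R) = Real.log 16 + Real.log R :=
    Real.log_mul (by norm_num) (by linarith)
  have hllN : Real.log (Real.log N) ≤ 2 * Real.log (Real.log R) := by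
    have h1 : Real.log (Real.log N) ≤ Real.log (Real.log (16 * R)) :=
      Real.log_le_log (by linarith) (Real.log_le_log (by linarith) hN16)
    exact h1.trans (log_log_sixteen_mul_le_two_mul hR16)
  have hllN0 : 0 ≤ Real.log (Real.log N) := Real.log_nonneg hlogN1
  have hKterm : K * N * Real.log (Real.log N) ≤ 32 * K' * R * Real.log (Real.log R) := by
    have h1 : K * N * Real.log (Real.log N) ≤ K' * N * Real.log (Real.log N) := by
      have : 0 ≤ N * Real.log (Real.log N) := mul_nonneg (by linarith) hllN0
      nlinarith
    have h2 : K' * N * Real.log (Real.log N) ≤ K' * (16 * R) * (2 * Real.log (Real.log R)) := by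
      have := mul_le_mul hN16 hllN hllN0 (by linarith)
      calc K' * N * Real.log (Real.log N) = K' * (N * Real.log (Real.log N)) := by ring
        _ ≤ K' * (16 * R * (2 * Real.log (Real.log R))) := mul_le_mul_of_nonneg_left this hK'0
        _ = K' * (16 * R) * (2 * Real.log (Real.log R)) := by ring
    linarith
  have hl16 := log_sixteen_le_d3
  have hl2 := Real.log_two_lt_d9
  -- assemble: `4 log M < 16 R log R + (32 K' + 52) R log log R`
  have hRll : R ≤ R * Real.log (Real.log R) := le_mul_of_one_le_right (by linarith) hllR
  have e : 16 * R * Real.log (16 * R) = 16 * Real.log 16 * R + 16 * R * Real.log R := by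
    rw [hlog16R]; ring
  have hA : 16 * Real.log 16 * R ≤ 44.48 * R := by
    have := mul_le_mul_of_nonneg_right hl16 (by linarith : (0 : ℝ) ≤ R)
    linarith
  have hB : (32 * K' + 52) * R * Real.log (Real.log R) =
      32 * K' * R * Real.log (Real.log R) + 52 * (R * Real.log (Real.log R)) := by ring
  have hmain : 4 * Real.log ((max |a| (max |b| |c|) : ℤ) : ℝ) ≤
      16 * R * Real.log R + (32 * K' + 52) * R * Real.log (Real.log R) := by
    rw [hB]; rw [e] at hNlogN; linarith
  have hC : (8 * K' + 13) * R * Real.log (Real.log R) =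
      ((32 * K' + 52) * R * Real.log (Real.log R)) / 4 := by ring
  rw [hC]
  linarith

/-! ### Thm 1.1, asymptotic clause, from Thm 1.2, asymptotic clause (§8, p. 3753) -/

/-- Coprime non-zero integers `A + B = C` rearrange into an `abc` triple `x + y = z` of positive
naturals with `xyz = |ABC|` and `z = max{|A|,|B|,|C|}`. [folklore] -/
private theorem exists_isABCTriple_of_int_add_eq {a b c : ℤ} (ha : a ≠ 0) (hb : b ≠ 0) (hc : c ≠ 0)
    (habc : a + b = c) (hg : Int.gcd (Int.gcd a b : ℤ) c = 1) :
    ∃ x y z : ℕ, IsABCTriple x y z ∧ x * y * z = (a * b * c).natAbs ∧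
      max a.natAbs (max b.natAbs c.natAbs) = z := by
  have hab : IsCoprime a b := isCoprime_of_gcd_gcd_eq_one habc hg
  have hac : IsCoprime a c := isCoprime_of_add_eq habc hg
  have hbc : IsCoprime b c := by
    refine isCoprime_of_add_eq (by rw [← habc]; ring : b + a = c) ?_
    rwa [Int.gcd_comm b a]
  have cop : ∀ {m n : ℤ}, IsCoprime m n → Nat.Coprime m.natAbs n.natAbs := by
    intro m n h
    rw [Nat.Coprime, ← Int.gcd_eq_natAbs]
    exact Int.isCoprime_iff_gcd_eq_one.mp h
  have hx : 0 < a.natAbs := Int.natAbs_pos.mpr ha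
  have hy : 0 < b.natAbs := Int.natAbs_pos.mpr hb
  have hz : 0 < c.natAbs := Int.natAbs_pos.mpr hc
  have hprod : a.natAbs * b.natAbs * c.natAbs = (a * b * c).natAbs := by
    rw [Int.natAbs_mul, Int.natAbs_mul]
  have hcases : a.natAbs + b.natAbs = c.natAbs ∨ a.natAbs + c.natAbs = b.natAbs ∨
      b.natAbs + c.natAbs = a.natAbs := by omega
  rcases hcases with h | h | h
  · refine ⟨a.natAbs, b.natAbs, c.natAbs, ⟨hx, hy, h, cop hab⟩, hprod, ?_⟩
    rw [max_eq_right (le_max_of_le_right (by omega)), max_eq_right (by omega)]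
  · refine ⟨a.natAbs, c.natAbs, b.natAbs, ⟨hx, hz, h, cop hac⟩, by rw [← hprod]; ring, ?_⟩
    rw [max_eq_right (le_max_of_le_left (by omega)), max_eq_left (by omega)]
  · refine ⟨b.natAbs, c.natAbs, a.natAbs, ⟨hy, hz, h, cop hbc⟩, by rw [← hprod]; ring, ?_⟩
    rw [max_eq_left (max_le (by omega) (by omega))]

/-- **Murty–Pasten 2013, §8: Thm 1.2 (asymptotic clause) ⟹ Thm 1.1 (asymptotic clause
`max{h(U), h(V)} ≤ 4 P log P + O(P log log P)`)** — the translation `U = A/C`, `V = B/C` of §8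
(p. 3753: "In particular `rad(ABC)` divides the product of the primes in `S`", `exists_abc_of_sUnit`)
for the triples with `rad(ABC)` above the threshold of Thm 1.2, where `R log R ≤ P log P` and
`R log log R ≤ P log log P`; the triples below the threshold have all prime factors `< r₁`, so they
are finitely many (Mahler 1933, in the tree `finite_setOf_isABCTriple_primeFactors_subset_holds`)
and their heights are absorbed in the `O`-constant (constant `max(C,0) + Z + 1`, threshold `16`).
PROVED implication between the named facts `abc_log_max_asymptotic` and `sUnit_height_asymptotic`
(the tree's `sUnit_height_asymptotic_of_abc` needs the explicit clause of Thm 1.2 as well).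
[cite: MurtyPasten2013, §8 (proof of Thm 1.1, p. 3753) with Thm 1.2 (second part)] [cite: Mahler1933a] -/
theorem sUnit_height_asymptotic_of_abc_log_max_asymptotic (hA : abc_log_max_asymptotic) :
    sUnit_height_asymptotic := by
  classical
  obtain ⟨C, r₀, hC⟩ := hA
  set r₁ : ℝ := max r₀ 16 with hr₁
  have hr₁16 : 16 ≤ r₁ := le_max_right _ _
  -- Mahler: the abc triples with all prime factors `≤ r₁` are finitely many; `Z` bounds their `c`
  set S₀ : Finset ℕ := Finset.range (⌊r₁⌋₊ + 1) with hS₀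
  have hF := finite_setOf_isABCTriple_primeFactors_subset_holds S₀
  obtain ⟨Z, hZ⟩ := (hF.image fun t : ℕ × ℕ × ℕ => t.2.2).bddAbove
  set K₀ : ℝ := (Z : ℝ) + 1 with hK₀
  have hK₀0 : 0 ≤ K₀ := by positivity
  have hC0 : 0 ≤ max C 0 := le_max_right _ _
  refine ⟨max C 0 + K₀, 16, fun S hS hP U V hU hV hUV => ?_⟩
  obtain ⟨A, B, D, hA0, hB0, hD, hABD, hg, hsub, hmax⟩ := exists_abc_of_sUnit hU hV hUV
  have hRP : ((radical (A * B * D).natAbs : ℕ) : ℝ) ≤ (primesProd S : ℝ) := by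
    exact_mod_cast radical_le_primesProd hS hsub
  have hR1 : (1 : ℝ) ≤ ((radical (A * B * D).natAbs : ℕ) : ℝ) := by
    exact_mod_cast Nat.radical_pos _
  set P : ℝ := (primesProd S : ℝ) with hPdef
  set R : ℝ := ((radical (A * B * D).natAbs : ℕ) : ℝ) with hRdef
  have hllP : 1 ≤ Real.log (Real.log P) := one_le_log_log_of_sixteen_le hP
  have hlP : 0 ≤ Real.log P := Real.log_nonneg (by linarith)
  have hPlP : 0 ≤ P * Real.log P := mul_nonneg (by linarith) hlP
  have hPllP : 1 ≤ P * Real.log (Real.log P) := by nlinarith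
  rcases le_or_gt r₁ R with hbig | hsmall
  · -- large radical: the asymptotic `abc` bound, then `R ≤ P`
    have h1 := hC A B D hA0 hB0 hD.ne' hABD hg ((le_max_left _ _).trans hbig)
    have hllR : 1 ≤ Real.log (Real.log R) := one_le_log_log_of_sixteen_le (hr₁16.trans hbig)
    have hlR : 0 < Real.log R := Real.log_pos (by linarith)
    have hRlR : R * Real.log R ≤ P * Real.log P := mul_log_mono_of_one_le (by linarith) hRP
    have hll : Real.log (Real.log R) ≤ Real.log (Real.log P) :=
      Real.log_le_log hlR (Real.log_le_log (by linarith) hRP)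
    have hRll : R * Real.log (Real.log R) ≤ P * Real.log (Real.log P) :=
      mul_le_mul hRP hll (by linarith) (by linarith)
    have hCterm : C * R * Real.log (Real.log R) ≤ max C 0 * (P * Real.log (Real.log P)) := by
      calc C * R * Real.log (Real.log R) ≤ max C 0 * (R * Real.log (Real.log R)) := by
            rw [mul_assoc]
            exact mul_le_mul_of_nonneg_right (le_max_left _ _) (by nlinarith)
        _ ≤ max C 0 * (P * Real.log (Real.log P)) := mul_le_mul_of_nonneg_left hRll hC0
    calc max (logHeight₁ U) (logHeight₁ V) ≤ _ := hmax
      _ ≤ 4 * R * Real.log R + C * R * Real.log (Real.log R) := h1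
      _ ≤ 4 * P * Real.log P + (max C 0 + K₀) * P * Real.log (Real.log P) := by nlinarith
  · -- small radical: all prime factors of `ABD` are `< r₁`, so the triple is one of finitely many
    obtain ⟨x, y, z, hxyz, hprod, hMz⟩ := exists_isABCTriple_of_int_add_eq hA0 hB0 hD.ne' hABD hg
    have hmem : (x, y, z) ∈ {t : ℕ × ℕ × ℕ | IsABCTriple t.1 t.2.1 t.2.2 ∧
        (t.1 * t.2.1 * t.2.2).primeFactors ⊆ S₀} := by
      refine ⟨hxyz, ?_⟩
      intro p hp
      simp only at hp
      rw [hprod, ← Nat.primeFactors_radical] at hp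
      have hple : p ≤ radical (A * B * D).natAbs :=
        Nat.le_of_dvd (Nat.radical_pos _) (Nat.dvd_of_mem_primeFactors hp)
      have hple' : (p : ℝ) ≤ r₁ := by
        have : (p : ℝ) ≤ R := by rw [hRdef]; exact_mod_cast hple
        linarith
      rw [hS₀, Finset.mem_range]
      exact Nat.lt_succ_of_le (Nat.le_floor hple')
    have hzZ : z ≤ Z := hZ ⟨(x, y, z), hmem, rfl⟩
    have hz1 : 1 ≤ z := by obtain ⟨hx0, -, hs, -⟩ := hxyz; omega
    have hlogM : Real.log ((max |A| (max |B| |D|) : ℤ) : ℝ) ≤ K₀ := by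
      rw [abs_max_eq_cast_natAbs_max, Int.cast_natCast, hMz]
      have hz' : (1 : ℝ) ≤ z := by exact_mod_cast hz1
      have hzZ' : (z : ℝ) ≤ Z := by exact_mod_cast hzZ
      have := Real.log_le_sub_one_of_pos (by linarith : (0 : ℝ) < z)
      rw [hK₀]; linarith
    calc max (logHeight₁ U) (logHeight₁ V) ≤ _ := hmax
      _ ≤ K₀ := hlogM
      _ ≤ K₀ * (P * Real.log (Real.log P)) := le_mul_of_one_le_right hK₀0 hPllP
      _ ≤ 4 * P * Real.log P + (max C 0 + K₀) * P * Real.log (Real.log P) := by nlinarith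

/-! ### On the A1.P base {modularity, Mazur–Kenku} -/

/-- **MP Thm 1.2, asymptotic clause, from modularity and Mazur–Kenku** (through MP's own chain:
Thm 4.3 asymptotic — DISCHARGED, `log_congruenceNumber_modularDegree_asymptotic_holds` — Prop 6.3,
Silverman, i.e. `height_discriminant_asymptotic_of_modularity_mazurKenku`, then §8 above). Replaces
the root `vonKanelMatschke_prop_10_8_i` of `abc_log_max_asymptotic_of_roots` by
`PastenShimura2024_minimalDegree_le_163_mul`. [cite: MurtyPasten2013, Thm 1.2 (p. 3741, second display), §8 and Thm 7.1] -/
theorem abc_log_max_asymptotic_of_modularity_mazurKenku (hmod : nonempty_modularParametrizationData)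
    (h163 : PastenShimura2024_minimalDegree_le_163_mul) : abc_log_max_asymptotic :=
  abc_log_max_asymptotic_of_height_discriminant_asymptotic
    (EllipticCurves.MurtyPasten.height_discriminant_asymptotic_of_modularity_mazurKenku hmod h163)

/-- **MP Thm 1.1, asymptotic clause, from Thm 7.1, asymptotic clause** (§8: via Thm 1.2).
[cite: MurtyPasten2013, Thm 1.1 (p. 3740, second display), §8] -/
theorem sUnit_height_asymptotic_of_height_discriminant_asymptotic
    (h71 : EllipticCurves.MurtyPasten.height_discriminant_asymptotic) : sUnit_height_asymptotic :=
  sUnit_height_asymptotic_of_abc_log_max_asymptotic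
    (abc_log_max_asymptotic_of_height_discriminant_asymptotic h71)

/-- **MP Thm 1.1, asymptotic clause, from modularity and Mazur–Kenku.**
[cite: MurtyPasten2013, Thm 1.1 (p. 3740, second display), §8 and Thm 7.1] -/
theorem sUnit_height_asymptotic_of_modularity_mazurKenku (hmod : nonempty_modularParametrizationData)
    (h163 : PastenShimura2024_minimalDegree_le_163_mul) : sUnit_height_asymptotic :=
  sUnit_height_asymptotic_of_abc_log_max_asymptotic
    (abc_log_max_asymptotic_of_modularity_mazurKenku hmod h163)

/-! ### The explicit `S`-unit bound the §8 argument yields on {modularity, Mazur–Kenku} -/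

/-- The bound `x ↦ 4.8 x log x + 13.31 x + 38.75` is monotone on `[1, ∞)`. [folklore] -/
private theorem weakBound_mono {x y : ℝ} (hx : 1 ≤ x) (hxy : x ≤ y) :
    4.8 * x * Real.log x + 13.31 * x + 38.75 ≤ 4.8 * y * Real.log y + 13.31 * y + 38.75 := by
  have := mul_log_mono_of_one_le hx hxy
  linarith

/-- **MP Thm 1.1's explicit clause in the form the §8 argument yields on {modularity, Mazur–Kenku}:
`max{h(U), h(V)} < 4.8 P log P + 13.31 P + 38.75`** for `U + V = 1` in `S`-units, `P = ∏_{p ∈ S} p`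
(proof of Thm 1.1, p. 3753: the triple `A + B = C` of `exists_abc_of_sUnit` has `rad(ABC) ≤ P`, and the
bound of `abc_log_max_lt_weak_of_modularity_mazurKenku` is monotone). DERIVED constants (print:
`13 P + 25`, named fact `sUnit_height_lt` ⇐ von Känel–Matschke's Prop. 10.2).
[cite: MurtyPasten2013, §8 (proof of Thm 1.1, p. 3753) with Thm 7.1] -/
theorem sUnit_height_lt_weak_of_modularity_mazurKenku (hmod : nonempty_modularParametrizationData)
    (h163 : PastenShimura2024_minimalDegree_le_163_mul) (S : Finset ℕ) (hS : ∀ p ∈ S, p.Prime)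
    (U V : ℚ) (hU : IsSUnit S U) (hV : IsSUnit S V) (hUV : U + V = 1) :
    max (logHeight₁ U) (logHeight₁ V) <
      4.8 * (primesProd S : ℝ) * Real.log (primesProd S) + 13.31 * (primesProd S : ℝ) + 38.75 := by
  obtain ⟨A, B, C, hA0, hB0, hC, hABC, hg, hsub, hmax⟩ := exists_abc_of_sUnit hU hV hUV
  have hlt := abc_log_max_lt_weak_of_modularity_mazurKenku hmod h163 hA0 hB0 hC.ne' hABC hg
  have hRP : ((radical (A * B * C).natAbs : ℕ) : ℝ) ≤ (primesProd S : ℝ) := by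
    exact_mod_cast radical_le_primesProd hS hsub
  have hR1 : (1 : ℝ) ≤ ((radical (A * B * C).natAbs : ℕ) : ℝ) := by
    exact_mod_cast Nat.radical_pos _
  exact (hmax.trans_lt hlt).trans_le (weakBound_mono hR1 hRP)

end MurtyPasten

end Literature.NumberTheory.DiophantineGeometry

end
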